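import Summits.BirchSwinnertonDyer.BirchSwinnertonDyer.Theorems.ThetaPartnerAtTwoSignedKatoUpToAtTwoKummerEquivariant
import Literature.NumberTheory.EllipticCurves.Sprung2012.ColemanTwistProofs
import HarnessLib

/-!
# Route `ThetaPartnerAtTwo` (TP2), crux K3 `SignedKatoDivisibilityUpToAtTwo` (item stmt-BirchSwinnertonDyer-20308),
# line `colemanrat` v4 — THE TWIST CONVENTION, KERNEL FORM: **pre-composition with the local generator `g` multiplies
# Coleman values by `(1+T)⁻¹`, while it is pre-composition with `g` (not `g⁻¹`) that realises `T + 1` on a pinned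
# `SignedSelmerDualData` through the points-model `j`** — the kernel half of the lead's convention audit
# (`Cruxes/SignedKatoDivisibilityUpToAtTwo/G4-CONVENTION-AUDIT.md`): the `Λ`-structure of the tree's dual data is carried to
# the functionals on `E(K_∞·K_v)` by `T ↦ (· ∘ g) − id`, under which Sprung's `Col` is multiplied by `ι(T) = (1+T)⁻¹ − 1`,
# NOT by `T`.

Lead `bsd-wall-tp2-p2x` g4 (cell `bsd-wall`). HONEST FRAMING: THEOREMS ONLY — no definition, no named fact, no instance, no `sorry`;
closes no item; BSD is NOT proved by any of this. What is NOT here: the Galois invariance of the local Tate pairing (not a tree object),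
which is the one further input of the audit's claim that `Col ∘ pairing : 𝐇¹ → Λ` is `Λ`-linear while `j ∘ pairing : 𝐇¹ → X^ε` is
`ι`-semilinear.

## What is proved

* §1 `isColemanPair_precomp` — if `(L♯, L♭)` is a Coleman pair of `z`, then `((1+T)⁻¹L♯, (1+T)⁻¹L♭)` is one of `z ∘ g`
  (`(1+T)⁻¹ = PowerSeries.invOfUnit (1+X) 1`; from `Sprung2012.pairingSum_twist`); `isColemanPair_precomp_sub` — `z ∘ g − z` has the
  pair `(((1+T)⁻¹ − 1)L♯, ((1+T)⁻¹ − 1)L♭)`. Compare `Sprung2012.IsColemanPair.twist_sub`: `z ∘ g⁻¹ − z ↦ (T·L♯, T·L♭)`.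
* §2 `toDual_X_smul_pointsModelJ_and_colemanPair_precomp_sub` — `K = ℚ`, cyclotomic `κ` with generator `γ` (`κ γ = 1`), `v ∋ p`, a local
  lift `g` with `κ(res g) = κ γ` (so `g` IS an `IsTopGenerator` for Sprung's theory): for every functional `z` on `E(ℚ_{∞,v})` with Coleman
  pair `(L♯, L♭)` (any Honda levels `c`), every pinned `D` and every points-model `j`: `X • j(z|_{A^ε}) = j((z ∘ g − z)|_{A^ε})` (w3's
  `toDual_X_smul_pointsModelJ`) AND `z ∘ g − z` has Coleman pair `((1+T)⁻¹ − 1)·(L♯, L♭)`.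

References: [Sprung2012] Def. 3.1, Def. 5.9 (p. 1495), §2 p. 1486 (`γ ↦ 1 + X`); [Kobayashi2003] §8.5 (p. 18); [Washington1997] §13.1.
-/

set_option autoImplicit false
-- the Theorems namespace of this sub repeats the summit name by design (D-0017 nested layout)
set_option linter.dupNamespace false

noncomputable section

open scoped Classical

namespace Summit.BirchSwinnertonDyer.BirchSwinnertonDyer.Theorems

namespace SignedKatoOffTwo.KummerPoint

open NumberField IsDedekindDomain Field WeierstrassCurve Polynomial
  Literature.NumberTheory.EllipticCurves Literature.NumberTheory.EllipticCurves.Kobayashi2003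
  Literature.NumberTheory.EllipticCurves.Sprung2012 Literature.NumberTheory.GaloisRepresentations ZpExtension
  Literature.NumberTheory.EllipticCurves.Sprung2017

universe u

/-! ## §1 Pre-composition with `g` divides Coleman values by `1 + T` -/

section Precomp

variable {K : Type u} [Field K] {p : ℕ} [Fact p.Prime] {κ : ZpExtension K p}
  {E : Type u} [Field E] [Algebra K E] {ι : AlgebraicClosure K →ₐ[K] AlgebraicClosure E} {W : WeierstrassCurve K}

/-- `(1+T)⁻¹ · (1+T) = 1` in `Λ` (`PowerSeries.invOfUnit`). [folklore] -/
theorem invOfUnit_oneAddX_mul :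
    PowerSeries.invOfUnit (1 + PowerSeries.X : IwasawaAlgebra p) 1 * (1 + PowerSeries.X) = 1 := by
  rw [mul_comm]
  exact PowerSeries.mul_invOfUnit _ _ (by rw [map_add, map_one, PowerSeries.constantCoeff_X, add_zero, Units.val_one])

/-- **`Col(z ∘ g) = (1+T)⁻¹·Col(z)`**: if `(L♯, L♭)` is a Coleman pair for `z` (levels `c_n ∈ E(K_n·K_v)`, `g` a local lift of the
topological generator, `κ(res g) = 1`), then `((1+T)⁻¹L♯, (1+T)⁻¹L♭)` is one for `w = z ∘ g` (`w(y) = z(g y)`): `z = w ∘ g⁻¹`, so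
`P_{n,c_n}(z) = (1+T)P_{n,c_n}(w) − w(g⁻¹c_n)·ω_n` (`Sprung2012.pairingSum_twist`). [cite: Sprung2012, Def. 3.1 (p. 1489), Def. 5.9 (p. 1495)] -/
theorem isColemanPair_precomp {ap : ℤ} {g : Field.absoluteGaloisGroup E} (hg : κ.IsTopGenerator (resGalOfEmb ι g))
    {c : ℕ → localPoints W E} (hc : ∀ n, c n ∈ localLayerPointsOfEmb κ ι W n)
    {z w : localTowerPointsOfEmb κ ι W →+ ℤ_[p]}
    (hw : ∀ y : localTowerPointsOfEmb κ ι W, w y = z ⟨g • (y : localPoints W E), smul_mem_localTowerPointsOfEmb κ ι W g y.2⟩)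
    {Ls Lf : IwasawaAlgebra p} (h : IsColemanPair κ ι W ap g c z Ls Lf) :
    IsColemanPair κ ι W ap g c w (PowerSeries.invOfUnit (1 + PowerSeries.X : IwasawaAlgebra p) 1 * Ls)
      (PowerSeries.invOfUnit (1 + PowerSeries.X : IwasawaAlgebra p) 1 * Lf) := by
  set v : IwasawaAlgebra p := PowerSeries.invOfUnit (1 + PowerSeries.X : IwasawaAlgebra p) 1 with hv
  have hv1 : v * (1 + PowerSeries.X) = 1 := invOfUnit_oneAddX_mul
  -- `z = w ∘ g⁻¹`
  have hz' : ∀ y : localTowerPointsOfEmb κ ι W,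
      z y = w ⟨g⁻¹ • (y : localPoints W E), smul_mem_localTowerPointsOfEmb κ ι W g⁻¹ y.2⟩ := by
    intro y
    rw [hw]
    congr 1
    apply Subtype.ext
    change (y : localPoints W E) = g • g⁻¹ • (y : localPoints W E)
    rw [smul_inv_smul]
  intro n
  have ht := pairingSum_twist κ ι W hg (hc n) w z hz'
  have hn := h n
  -- multiply the relation for `z` by `v` and substitute
  have key : pairingSum W (localTowerPointsOfEmb κ ι W) g n (c n) w +
      (toIwasawa p (sharpPoly ap p n) * (v * Ls) + toIwasawa p (flatPoly ap p n) * (v * Lf)) =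
      v * (pairingSum W (localTowerPointsOfEmb κ ι W) g n (c n) z +
        (toIwasawa p (sharpPoly ap p n) * Ls + toIwasawa p (flatPoly ap p n) * Lf)) +
      v * PowerSeries.C (w ⟨g⁻¹ • c n, smul_mem_localTowerPointsOfEmb κ ι W g⁻¹
          (localLayerPointsOfEmb_le_localTowerPointsOfEmb κ ι W n (hc n))⟩) * toIwasawa p (cyclotomicOmega p n) := by
    linear_combination (-(pairingSum W (localTowerPointsOfEmb κ ι W) g n (c n) w)) * hv1 + (-v) * ht
  rw [key]
  exact dvd_add (dvd_mul_of_dvd_right hn _) (dvd_mul_left _ _)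

/-- **`Col(z ∘ g − z) = ((1+T)⁻¹ − 1)·Col(z)`** — contrast `Sprung2012.IsColemanPair.twist_sub`: `Col(z ∘ g⁻¹ − z) = T·Col(z)`.
[cite: Sprung2012, Def. 5.9 (p. 1495) and §2 p. 1486] -/
theorem isColemanPair_precomp_sub {ap : ℤ} {g : Field.absoluteGaloisGroup E} (hg : κ.IsTopGenerator (resGalOfEmb ι g))
    {c : ℕ → localPoints W E} (hc : ∀ n, c n ∈ localLayerPointsOfEmb κ ι W n)
    {z w : localTowerPointsOfEmb κ ι W →+ ℤ_[p]}
    (hw : ∀ y : localTowerPointsOfEmb κ ι W, w y = z ⟨g • (y : localPoints W E), smul_mem_localTowerPointsOfEmb κ ι W g y.2⟩)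
    {Ls Lf : IwasawaAlgebra p} (h : IsColemanPair κ ι W ap g c z Ls Lf) :
    IsColemanPair κ ι W ap g c (w - z) ((PowerSeries.invOfUnit (1 + PowerSeries.X : IwasawaAlgebra p) 1 - 1) * Ls)
      ((PowerSeries.invOfUnit (1 + PowerSeries.X : IwasawaAlgebra p) 1 - 1) * Lf) := by
  have h2 := (isColemanPair_precomp hg hc hw h).sub h
  rwa [← sub_one_mul, ← sub_one_mul] at h2

end Precomp

/-! ## §2 `K = ℚ`: the `T`-action on the points-model `j` is realised by `z ↦ z ∘ g − z`, whose Coleman value is `((1+T)⁻¹ − 1)·Col(z)` -/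

section Rat

variable (W : WeierstrassCurve ℚ) {p : ℕ} [Fact p.Prime] (κ : ZpExtension ℚ p) {γ : absoluteGaloisGroup ℚ} (ε : ℤˣ)

/-- **The twist convention, side by side.** `K = ℚ`, `v ∋ p`, `g ∈ Γ_{ℚ_v}` a local lift with `κ(res g) = κ γ` and `κ γ = 1` (so `g` is the
`IsTopGenerator` of Sprung's Coleman theory), `A^ε = ⨆ₙ E^ε_n` (stable under `g`), `z` a functional on `E(ℚ_∞·ℚ_v)` with Coleman pair
`(L♯, L♭)` for levels `c`, `w = z ∘ g`. Then for every pinned `D` and every points-model `j` (value formula of `exists_pointsModelJ`):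
(i) `D.toDual (X • j (z|_A)) s = D.toDual (j (w|_A)) s − D.toDual (j (z|_A)) s` for all `s ∈ Sel^ε_∞` (w3's `toDual_X_smul_pointsModelJ`), and
(ii) `w − z` has Coleman pair `(((1+T)⁻¹ − 1)L♯, ((1+T)⁻¹ − 1)L♭)`. So through `j` the tree's `T` on `X^ε` meets `ι(T) = (1+T)⁻¹ − 1` on
Coleman values. [cite: Kobayashi2003, §8.5 (p. 18)] [cite: Sprung2012, Def. 3.1 and Def. 5.9] [cite: Washington1997, §13.1] -/
theorem toDual_X_smul_pointsModelJ_and_colemanPair_precomp_sub (v : HeightOneSpectrum (𝓞 ℚ)) (hv : (p : 𝓞 ℚ) ∈ v.asIdeal)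
    (hγ : κ.IsTopGenerator γ)
    (g : absoluteGaloisGroup (v.adicCompletion ℚ)) (hgγ : κ γ = κ (resGalOfEmb (closureEmb (K := ℚ) (v.adicCompletion ℚ)) g))
    (hA : ∀ a ∈ (⨆ n, signedLocalPoints κ (v.adicCompletion ℚ) W ε n), g • a ∈ (⨆ n, signedLocalPoints κ (v.adicCompletion ℚ) W ε n))
    {ap : ℤ} {c : ℕ → localPoints W (v.adicCompletion ℚ)} (hc : ∀ n, c n ∈ localLayerPoints κ (v.adicCompletion ℚ) W n)
    {z w : localTowerPointsOfEmb κ (closureEmb (K := ℚ) (v.adicCompletion ℚ)) W →+ ℤ_[p]}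
    (hw : ∀ y : localTowerPointsOfEmb κ (closureEmb (K := ℚ) (v.adicCompletion ℚ)) W,
      w y = z ⟨g • (y : localPoints W (v.adicCompletion ℚ)), smul_mem_localTowerPointsOfEmb κ _ W g y.2⟩)
    {Ls Lf : IwasawaAlgebra p} (h : IsColemanPair κ (closureEmb (K := ℚ) (v.adicCompletion ℚ)) W ap g c z Ls Lf)
    (D : SignedSelmerDualData W κ γ ε)
    (j : (↥(⨆ n, signedLocalPoints κ (v.adicCompletion ℚ) W ε n) →+ ℤ_[p]) →+ D.X)
    (hj : ∀ (φA : ↥(⨆ n, signedLocalPoints κ (v.adicCompletion ℚ) W ε n) →+ ℤ_[p])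
        (s : W.subgroupH1 p κ.kerSubgroup) (hs : s ∈ signedSelmerInfty W κ ε)
        (φ : contOneCocycles (discreteTopRep κ.kerSubgroup (W.geomPrimaryTorsion p)))
        (Q : localPoints W (v.adicCompletion ℚ)) (k : ℕ)
        (_ : oneCocycleClass _ φ = s) (hQ : p ^ k • Q ∈ (⨆ n, signedLocalPoints κ (v.adicCompletion ℚ) W ε n))
        (_ : ∀ τ : localSubgroupOfEmb κ.kerSubgroup (closureEmb (K := ℚ) (v.adicCompletion ℚ)),
          pointsMapOfEmb W (closureEmb (K := ℚ) (v.adicCompletion ℚ))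
              ((φ.1 (resGalSubgroupOfEmb κ.kerSubgroup _ τ) : W.geomPrimaryTorsion p) : W.geomPoints) =
            (τ : absoluteGaloisGroup (v.adicCompletion ℚ)) • Q - Q),
        D.toDual (j φA) ⟨s, hs⟩ =
          (PadicInt.toZModPow k (φA ⟨p ^ k • Q, hQ⟩)).val • ((((p : ℚ) ^ k)⁻¹ : ℚ) : AddCircle (1 : ℚ)))
    (hle : (⨆ n, signedLocalPoints κ (v.adicCompletion ℚ) W ε n) ≤ localTowerPointsOfEmb κ (closureEmb (K := ℚ) (v.adicCompletion ℚ)) W)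
    (s : W.subgroupH1 p κ.kerSubgroup) (hs : s ∈ signedSelmerInfty W κ ε) :
    D.toDual ((PowerSeries.X : IwasawaAlgebra p) • j (z.comp (AddSubgroup.inclusion hle))) ⟨s, hs⟩ =
        D.toDual (j (w.comp (AddSubgroup.inclusion hle))) ⟨s, hs⟩ - D.toDual (j (z.comp (AddSubgroup.inclusion hle))) ⟨s, hs⟩ ∧
      IsColemanPair κ (closureEmb (K := ℚ) (v.adicCompletion ℚ)) W ap g c (w - z)
        ((PowerSeries.invOfUnit (1 + PowerSeries.X : IwasawaAlgebra p) 1 - 1) * Ls)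
        ((PowerSeries.invOfUnit (1 + PowerSeries.X : IwasawaAlgebra p) 1 - 1) * Lf) := by
  have hg : κ.IsTopGenerator (resGalOfEmb (closureEmb (K := ℚ) (v.adicCompletion ℚ)) g) := by
    rw [ZpExtension.IsTopGenerator, ← hgγ]; exact hγ
  refine ⟨?_, isColemanPair_precomp_sub hg hc hw h⟩
  rw [toDual_X_smul_pointsModelJ W κ ε v hv g hgγ hA D j hj _ s hs]
  have hfun : (z.comp (AddSubgroup.inclusion hle)).comp
      (((DistribSMul.toAddMonoidHom (localPoints W (v.adicCompletion ℚ)) g).comp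
        (⨆ n, signedLocalPoints κ (v.adicCompletion ℚ) W ε n).subtype).codRestrict
          (⨆ n, signedLocalPoints κ (v.adicCompletion ℚ) W ε n) (fun a ↦ hA a a.2)) =
      w.comp (AddSubgroup.inclusion hle) := by
    ext a
    change z ⟨g • (a : localPoints W (v.adicCompletion ℚ)), _⟩ = w ⟨(a : localPoints W (v.adicCompletion ℚ)), _⟩
    rw [hw]
  rw [hfun]

end Rat

end SignedKatoOffTwo.KummerPoint

end Summit.BirchSwinnertonDyer.BirchSwinnertonDyer.Theorems

end
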